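import Summits.CriticalPhenomena.CardyFormulaZ2.Theses.ModulusResponse
import Summits.CriticalPhenomena.CardyFormulaZ2.Theorems.ModulusResponseSegmentTransportKernelIffCrux

/-!
# Birth skeleton of the crux `SegmentTransport` (stmt-CriticalPhenomena-11199, route `ModulusResponse`)
# — line `birth`, v4 (lead c3, 2026-08-17): everything but the kernel is in the tree

Line `birth` = the route's own two-layer plan for this crux ("SegmentTransport ⇐ UniformCompensation →
TelescopingBookkeeping"), typed. Notation: `μ_u` the pinned self-dual cell family on `ℤ²` (`u ∈ [0,1/2]`),
`S_t z = cosh t · z + i sinh t · z̄` the pinned diagonal stretches, `P_u(t, R, δ) = μ_u[G02 crossing of S_t(R) at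
mesh δ]`, `F` = Cardy's function.

State of the line (v4). In the tree (`Theorems/ModulusResponseSegmentTransport*.lean`):
* `stub_exactFromApproximate` (p146443) and `stub_relativeConfinement` (p148123), packaged as
  `exact_of_forall_approx` (p149256): for ANY set function, "ε-approximately linear-image Cardy for every ε" ⇒
  "exactly linear-image Cardy for one stretch" (relative confinement + Bolzano–Weierstrass + Radó);
* `telescoping`, `segmentTransport_of_uniformCompensation` (kernel ⇒ crux), `uniformCompensation_of_segmentTransport`
  (crux ⇒ kernel, via `smirnovCellAnchor_proof`) and `uniformCompensation_iff_segmentTransport`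
  (`…SegmentTransportKernelIffCrux.lean`): the kernel below is Lean-EQUIVALENT to the crux.
So this skeleton is two lines long: the crux is closed modulo the ONE stub `stub_uniformCompensation`, and that stub is
exactly crux-sized — its content at `u ∈ (0,1/2]` is the Bollobás–Riordan (2010, p. 40) linear-image conjecture for the
self-dual cell family (universality of critical planar percolation modulo a linear map), open even for `u` arbitrarily
close to the solved point `u = 0` (the first Euler step is the whole difficulty).

Disproof used: none on file for this crux (`ledger crux ls`: no Disproof.lean, 2026-08-17T09:30Z).
-/

namespace Summit.CriticalPhenomena.CardyFormulaZ2.Cruxes.SegmentTransport.Birth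

open Filter Topology

/-- **STUB (kernel) — uniform first-order compensation along the segment.** For the pinned cell
family `μ_u` and stretches `S_t`, given uniform RSW on `[0,1/2]` and the `u = 0` response law: for every
`η > 0` there is `Δ₀ > 0` such that for `0 ≤ u ≤ u' ≤ u + Δ₀`, `u' ≤ 1/2`, some extra stretch `c` gives
`limsup_{δ→0⁺} |P_{u'}(t + c, R, δ) - P_u(t, R, δ)| ≤ η (u' - u)` for ALL `t` and ALL conformal rectangles `R`
(stated with an `ε` of room inside `∀ᶠ δ`). Why plausibly true: it is what linear response / the effective
linear map predicts (`c = τ(u') - τ(u)`), and it asks for no limit. Why it might fail: δ-uniform control of the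
`o(Δu)` remainder needs subleading pivotal-anisotropy bounds at an unsolved point (the crux's own risk).
Size: XL (research). Leans on: `SegmentRSW`-type input (hypothesis), `SmirnovResponse` conclusion (hypothesis),
GarbanPeteSchramm2013Pivotal, Beffara2008Universal §5.2. -/
theorem stub_uniformCompensation :
    ∀ (μ : ℝ → MeasureTheory.Measure (Literature.Probability.Percolation.BondConfig (Literature.Probability.LatticeModels.Site 2))) (S : ℝ → ℂ → ℂ), (∀ u, μ u = MeasureTheory.Measure.map (fun p : Set (Literature.Probability.LatticeModels.Site 2) × Set (Literature.Probability.LatticeModels.Site 2) ↦ {e | ∃ m, (m ∈ p.1 ∧ e = s(m - Pi.single 0 1, m)) ∨ ((m ∈ p.1 ↔ m ∉ p.2) ∧ e = s(m - Pi.single 1 1, m))}) ((ProbabilityTheory.setBernoulli Set.univ Literature.Probability.Percolation.half).prod (ProbabilityTheory.setBernoulli Set.univ (Set.projIcc 0 1 zero_le_one u)))) → (∀ t z, S t z = (Real.cosh t : ℂ) * z + Complex.I * (Real.sinh t : ℂ) * (starRingEnd ℂ) z) → (∃ c : ℝ, 0 < c ∧ ∀ u ∈ Set.Icc (0 : ℝ)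 (1 / 2), ∀ n : ℕ, 1 ≤ n → c ≤ (μ u).real (Literature.Probability.Percolation.lrCrossing (2 * n) n) ∧ c ≤ (μ u).real (Literature.Probability.Percolation.tbCrossing n (2 * n))) → (∃ k : ℝ, ∀ (R : Literature.Probability.RandomPlanarGeometry.ConformalRectangle) (t L : ℝ), HasDerivAt (fun s : ℝ ↦ Filter.limUnder (nhdsWithin (0 : ℝ) (Set.Ioi 0)) (fun δ ↦ (μ 0).real (Literature.Probability.Percolation.discreteCrossing (S s '' R.carrier) δ (S s '' R.arc 0) (S s '' R.arc 2)))) L t → Filter.Tendsto (fun δ ↦ derivWithin (fun u ↦ (μ u).real (Literature.Probability.Percolation.discreteCrossing (S t '' R.carrier) δ (S t '' R.arc 0) (S t '' R.arc 2))) (Set.Ici 0) 0) (nhdsWithin 0 (Set.Ioi 0)) (nhds (k * L))) → ∀ η : ℝ, 0 < η → ∃ Δ₀ : ℝ, 0 < Δ₀ ∧ ∀ u ∈ Set.Icc (0 : ℝ) (1 / 2), ∀ u' ∈ Set.Icc (0 : ℝ) (1 / 2), u ≤ u' → u' ≤ u + Δ₀ → ∃ c : ℝ, ∀ (t : ℝ)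 (R : Literature.Probability.RandomPlanarGeometry.ConformalRectangle) (ε : ℝ), 0 < ε → ∀ᶠ δ in nhdsWithin (0 : ℝ) (Set.Ioi 0), |(μ u').real (Literature.Probability.Percolation.discreteCrossing (S (t + c) '' R.carrier) δ (S (t + c) '' R.arc 0) (S (t + c) '' R.arc 2)) - (μ u).real (Literature.Probability.Percolation.discreteCrossing (S t '' R.carrier) δ (S t '' R.arc 0) (S t '' R.arc 2))| ≤ η * (u' - u) + ε := by
  sorry

/-- **The line closes the crux** (the skeleton's concluding theorem; its only unproved dependency is the declared
kernel stub, used BY NAME): `ModulusResponse.SegmentTransport`, by the tree's `segmentTransport_of_uniformCompensation`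
(telescoping from the anchor + the landed bootstrap `exact_of_forall_approx`). -/
theorem SegmentTransport_of :
    Summit.CriticalPhenomena.CardyFormulaZ2.Theses.ModulusResponse.SegmentTransport :=
  segmentTransport_of_uniformCompensation stub_uniformCompensation

end Summit.CriticalPhenomena.CardyFormulaZ2.Cruxes.SegmentTransport.Birth
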